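import Summits.BirchSwinnertonDyer.BirchSwinnertonDyer.Theorems.AlignedTransportAtTwoMainConjectureOfRankZeroBSDAtTwoCubicTowerJumps
import Literature.NumberTheory.NumberFields.ClassNumberDivisibilityInExtensions
import HarnessLib

/-!
# Route `AlignedTransportAtTwo`, crux C2 `MainConjectureOfRankZeroBSDAtTwo` (stmt-BirchSwinnertonDyer-22298):
# THE 2-CLASS NUMBER AT LEAST DOUBLES AT EVERY LAYER of the cyclotomic `ℤ₂`-tower of a Kilford cubic field — monotonicity
# `h(K_n) ∣ h(K_{n+1})` (a totally ramified prime, Washington Prop. 4.11) + the jump of `…CubicTowerJumps` ⟹ `e_{n+1} ≥ e_n + 1`, `e_n ≥ e_0 + n`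

HONEST FRAMING (cell `bsd-f1-sign2`, WIDTH-5 attached prover seat `bsd-line-att-p3` gen 25 on line `birth` of the lead `bsd-line-att-p2`;
`--supports` stmt-BirchSwinnertonDyer-22298, closes nothing; BSD is NOT proved by any of this; the crux C2, its verdict «blocked-on
`Rank1Residual.GreenbergMuConjectureIrreducible`» and every registered stub are untouched). THEOREMS ONLY — no definition, no named fact,
no `sorry`.

Third file of this seat's «Chevalley along the whole tower» (`…CubicTowerGrowth`: `e_0 + m·n ≤ e_n + 2n + 1`; `…CubicTowerJumps`: `e_{n+1} ≠ e_n`).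
* `classNumberPExp_le_succ` — `K` of odd degree, `κ` cyclotomic, every place above `2` of odd index: **`e_n ≤ e_{n+1}`** for every `n`
  (indeed `h(K_n) ∣ h(K_{n+1})`): a prime `Q ∣ 2` of `K_{n+1}` is totally ramified over `K` (`ramificationIdxIn_layer_eq_pow`), hence over `K_n`
  (`e(Q ∣ w) = e(Q ∩ K_n ∣ w) · e(Q ∣ Q ∩ K_n)` with `e(Q ∩ K_n ∣ w) ≤ [K_n : K]`, Mathlib `Ideal.ramificationIdx_tower`, `ramificationIdx_le_finrank`),
  and `h_{K_n} ∣ h_{K_{n+1}}` by Washington Prop. 4.11 (tree `classNumber_dvd_classNumber_of_ramificationIdx_eq_finrank`).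
* `classNumberPExp_succ_le_succ`, `classNumberPExp_zero_add_le` — with unit rank `1` and three places above `2`: **`e_{n+1} ≥ e_n + 1`** and
  **`e_n ≥ e_0 + n`** (sharpening Chevalley's `e_0 + n − 1`): the `2`-class number at least doubles at every layer.
* `classNumberPExp_strict_growth_of_cubic` — cubic currency (complex cubic field, `2` totally split); `…_seedCubicField` — the cubic `2`-torsion
  field of a seed-cell curve with `Δ_W < 0` and three places above `2` in `ℚ(β)` (all twelve certified seeds).

References: [Washington1997] Prop. 4.11, §13.1; [Lang1990] Ch. 3 §4 (Lemma to Thm. 4.3), Ch. 13 §4 Lemma 4.1; [Fukuda1994] Thm. 1 (1), p. 264;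
tree `ClassNumberDivisibilityInExtensions`, `…CubicTowerGrowth`, `…CubicTowerJumps`.
-/

set_option linter.dupNamespace false
set_option autoImplicit false

noncomputable section

open scoped Classical NumberField nonZeroDivisors

namespace Summit.BirchSwinnertonDyer.BirchSwinnertonDyer.Theorems.AlignedTransportAtTwoCubicTowerStrict

open NumberField IsDedekindDomain
open Literature.NumberTheory.NumberFields Literature.NumberTheory.GaloisRepresentations Literature.NumberTheory.IwasawaTheory
  Literature.NumberTheory.EllipticCurves
  Summit.BirchSwinnertonDyer.BirchSwinnertonDyer.Theorems.AddKatoTwo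
  Summit.BirchSwinnertonDyer.BirchSwinnertonDyer.Theorems.AlignedTransportAtTwoCubicLayerOneParity
  Summit.BirchSwinnertonDyer.BirchSwinnertonDyer.Theorems.AlignedTransportAtTwoCubicLayerOneDoors
  Summit.BirchSwinnertonDyer.BirchSwinnertonDyer.Theorems.AlignedTransportAtTwoCubicTowerGrowth
  Summit.BirchSwinnertonDyer.BirchSwinnertonDyer.Theorems.AlignedTransportAtTwoCubicTowerJumps

/-! ## §6 Monotonicity `h(K_n) ∣ h(K_{n+1})` (a totally ramified prime, Washington Prop. 4.11) and STRICT growth `e_n ≥ e_0 + n` -/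

section Monotone

variable {K : Type} [Field K] [NumberField K]

/-- **`h(K_n) ∣ h(K_{n+1})` along the cyclotomic `ℤ₂`-tower** of a field `K` of odd degree all of whose places above `2` have odd absolute
index: a prime of `K_{n+1}` above `2` is totally ramified over `K` (`ramificationIdxIn_layer_eq_pow`), hence over `K_n`
(`e(Q ∣ w) = e(Q_n ∣ w) · e(Q ∣ Q_n)`, `e(Q_n ∣ w) ≤ [K_n : K]`), and an extension with a totally ramified prime meets the Hilbert class field of
the base trivially (Washington Prop. 4.11, tree `classNumber_dvd_classNumber_of_ramificationIdx_eq_finrank`).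
[cite: Washington1997, Prop. 4.11 and §13.1] [cite: Lang1990, Ch. 3 §4, Lemma to Thm. 4.3] -/
theorem classNumberPExp_le_succ (hK2 : ¬ 2 ∣ Module.finrank ℚ K) (κ : ZpExtension K 2) (hκ : κ.IsCyclotomic)
    (hodd : ∀ w : HeightOneSpectrum (𝓞 K), ((2 : ℕ) : 𝓞 K) ∈ w.asIdeal → Odd (w.asIdeal.ramificationIdx ℤ)) (n : ℕ) :
    classNumberPExp κ n ≤ classNumberPExp κ (n + 1) := by
  classical
  haveI : Fact (Nat.Prime 2) := ⟨Nat.prime_two⟩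
  haveI : FiniteDimensional K (κ.layer n) := κ.finiteDimensional_layer_holds n
  haveI : FiniteDimensional K (κ.layer (n + 1)) := κ.finiteDimensional_layer_holds (n + 1)
  haveI : IsGalois K (κ.layer (n + 1)) := κ.isGalois_layer_holds (n + 1)
  haveI : NumberField (κ.layer n) := NumberField.of_module_finite K _
  haveI : NumberField (κ.layer (n + 1)) := NumberField.of_module_finite K _
  -- `K_n` as an intermediate field `B` of `T = K_{n+1}`
  have hle : κ.layer n ≤ κ.layer (n + 1) := κ.layer_mono (Nat.le_succ n)
  obtain ⟨B, hB⟩ : ∃ B : IntermediateField K (κ.layer (n + 1)), B = IntermediateField.restrict hle := ⟨_, rfl⟩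
  let eB : (κ.layer n) ≃ₐ[K] B := (IntermediateField.restrict_algEquiv hle).trans (IntermediateField.equivOfEq hB.symm)
  haveI : FiniteDimensional K B := LinearEquiv.finiteDimensional eB.toLinearEquiv
  haveI : NumberField B := NumberField.of_module_finite K _
  have hclB : classNumber B = classNumber (κ.layer n) :=
    (Fintype.card_congr (ClassGroup.mulEquiv (RingOfIntegers.mapRingEquiv eB.toRingEquiv)).toEquiv).symm
  have hdegKB : Module.finrank K B = 2 ^ n := by rw [← eB.toLinearEquiv.finrank_eq, κ.finrank_layer_holds n]
  have hdegBT : Module.finrank B (κ.layer (n + 1)) = 2 := by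
    have h := Module.finrank_mul_finrank K B (κ.layer (n + 1))
    rw [hdegKB, κ.finrank_layer_holds (n + 1), pow_succ] at h
    exact Nat.eq_of_mul_eq_mul_left (pow_pos two_pos n) h
  -- a place `w ∣ 2` of `K`
  haveI : (Ideal.span {(2 : ℤ)}).IsMaximal :=
    Ideal.IsPrime.isMaximal ((Ideal.span_singleton_prime two_ne_zero).mpr Int.prime_two) (by simp)
  obtain ⟨⟨P2, hP2prime, hP2over⟩⟩ := (inferInstance : Nonempty (Ideal.primesOver (Ideal.span {(2 : ℤ)}) (𝓞 K)))
  haveI := hP2prime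
  haveI := hP2over
  have hP2ne : P2 ≠ ⊥ := Ideal.ne_bot_of_liesOver_of_ne_bot (by simp : (Ideal.span {(2 : ℤ)} : Ideal ℤ) ≠ ⊥) P2
  let w : HeightOneSpectrum (𝓞 K) := ⟨P2, hP2prime, hP2ne⟩
  have hw : ((2 : ℕ) : 𝓞 K) ∈ w.asIdeal := by
    have h2 := (Ideal.liesOver_span_iff hP2prime.ne_top Int.prime_two).mp hP2over
    rw [map_ofNat] at h2
    exact_mod_cast h2
  -- a prime `Q ∣ w` of `K_{n+1}`, totally ramified over `K`
  haveI : w.asIdeal.IsPrime := w.isPrime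
  obtain ⟨⟨Q, hQprime, hQover⟩⟩ := (inferInstance : Nonempty (Ideal.primesOver w.asIdeal (𝓞 (κ.layer (n + 1)))))
  haveI := hQprime
  haveI := hQover
  haveI : Module.Finite (𝓞 K) (𝓞 (κ.layer (n + 1))) := IsIntegralClosure.finite (𝓞 K) K (κ.layer (n + 1)) (𝓞 (κ.layer (n + 1)))
  haveI : IsGaloisGroup ((κ.layer (n + 1)) ≃ₐ[K] (κ.layer (n + 1))) (𝓞 K) (𝓞 (κ.layer (n + 1))) :=
    IsGaloisGroup.of_isFractionRing _ (𝓞 K) (𝓞 (κ.layer (n + 1))) K (κ.layer (n + 1))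
  have he : Q.ramificationIdx (𝓞 K) = 2 ^ (n + 1) := by
    rw [← Ideal.ramificationIdxIn_eq_ramificationIdx w.asIdeal Q ((κ.layer (n + 1)) ≃ₐ[K] (κ.layer (n + 1)))]
    exact ramificationIdxIn_layer_eq_pow hK2 κ hκ hodd hw (Nat.succ_pos n)
  -- `Q_B = Q ∩ 𝓞 B`; `e(Q ∣ w) = e(Q_B ∣ w) · e(Q ∣ Q_B)`
  haveI hQBprime : (Q.under (𝓞 B)).IsPrime := Ideal.IsPrime.under (𝓞 B) Q
  have htower := Ideal.ramificationIdx_tower (R := 𝓞 K) (Q.under (𝓞 B)) Q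
  have hQ0 : Q ≠ ⊥ := Ideal.ne_bot_of_liesOver_of_ne_bot w.ne_bot Q
  have hQB0 : Q.under (𝓞 B) ≠ ⊥ := Ideal.ne_bot_of_liesOver_of_ne_bot w.ne_bot (Q.under (𝓞 B))
  haveI hQBmax : (Q.under (𝓞 B)).IsMaximal := hQBprime.isMaximal hQB0
  haveI hwmax : w.asIdeal.IsMaximal := w.isPrime.isMaximal w.ne_bot
  haveI : NoZeroSMulDivisors (𝓞 K) (𝓞 B) := ⟨fun {c x} h => by
    rw [Algebra.smul_def, mul_eq_zero] at h
    exact h.imp_left fun hc => FaithfulSMul.algebraMap_injective (𝓞 K) (𝓞 B) (by rw [hc, map_zero])⟩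
  haveI : NoZeroSMulDivisors (𝓞 B) (𝓞 (κ.layer (n + 1))) := ⟨fun {c x} h => by
    rw [Algebra.smul_def, mul_eq_zero] at h
    exact h.imp_left fun hc => FaithfulSMul.algebraMap_injective (𝓞 B) (𝓞 (κ.layer (n + 1))) (by rw [hc, map_zero])⟩
  have hle1 : (Q.under (𝓞 B)).ramificationIdx (𝓞 K) ≤ 2 ^ n := by
    rw [← Ideal.ramificationIdx'_eq_ramificationIdx w.asIdeal (Q.under (𝓞 B)) w.ne_bot, ← hdegKB]
    exact Ideal.ramificationIdx_le_finrank (S := 𝓞 B) (K := K) (L := B) (P := Q.under (𝓞 B))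
  have hle2 : Q.ramificationIdx (𝓞 B) ≤ 2 := by
    have h := Ideal.ramificationIdx_le_finrank (S := 𝓞 (κ.layer (n + 1))) (K := B) (L := κ.layer (n + 1))
      (p := Q.under (𝓞 B)) (P := Q)
    rw [Ideal.ramificationIdx'_eq_ramificationIdx (Q.under (𝓞 B)) Q hQB0, hdegBT] at h
    exact h
  have heq2 : Q.ramificationIdx (𝓞 B) = 2 := by
    rw [he, pow_succ] at htower
    rcases Nat.lt_or_ge (Q.ramificationIdx (𝓞 B)) 2 with hlt | hge
    · exfalso
      have : 2 ^ n * 2 ≤ 2 ^ n * 1 := by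
        calc 2 ^ n * 2 = (Q.under (𝓞 B)).ramificationIdx (𝓞 K) * Q.ramificationIdx (𝓞 B) := htower
          _ ≤ 2 ^ n * 1 := Nat.mul_le_mul hle1 (by omega)
      have hpos : 0 < 2 ^ n := pow_pos two_pos n
      omega
    · omega
  haveI : Q.IsMaximal := hQprime.isMaximal hQ0
  have hdvd := classNumber_dvd_classNumber_of_ramificationIdx_eq_finrank B (κ.layer (n + 1)) Q (by rw [heq2, hdegBT])
  rw [hclB] at hdvd
  rw [classNumberPExp_eq_padicValNat_classNumber, classNumberPExp_eq_padicValNat_classNumber]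
  exact (padicValNat_dvd_iff_le (classNumber_ne_zero _)).mp (pow_padicValNat_dvd.trans hdvd)

/-- **STRICT GROWTH: `e_{n+1} ≥ e_n + 1`** for `K` of odd degree and unit rank `1`, `κ` cyclotomic, all places above `2` of odd index and at least
three of them (monotonicity `classNumberPExp_le_succ` + `classNumberPExp_succ_ne`): the `2`-class number at least DOUBLES at every layer.
[cite: Fukuda1994, Thm. 1 (1), p. 264] [cite: Washington1997, Prop. 4.11] [cite: Lang1990, Ch. 13 §4, Lemma 4.1] -/
theorem classNumberPExp_succ_le_succ (hK2 : ¬ 2 ∣ Module.finrank ℚ K) (hrank : Units.rank K = 1)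
    (κ : ZpExtension K 2) (hκ : κ.IsCyclotomic)
    (hodd : ∀ w : HeightOneSpectrum (𝓞 K), ((2 : ℕ) : 𝓞 K) ∈ w.asIdeal → Odd (w.asIdeal.ramificationIdx ℤ))
    (h3 : 3 ≤ {w : HeightOneSpectrum (𝓞 K) | ((2 : ℕ) : 𝓞 K) ∈ w.asIdeal}.ncard) (n : ℕ) :
    classNumberPExp κ n + 1 ≤ classNumberPExp κ (n + 1) := by
  have h1 := classNumberPExp_le_succ hK2 κ hκ hodd n
  have h2 := classNumberPExp_succ_ne hK2 hrank κ hκ hodd h3 n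
  omega

/-- **`e_n ≥ e_0 + n` at every layer** (induction on `classNumberPExp_succ_le_succ`): `2^{e_0 + n} ∣ h(K_n)`.
[cite: Fukuda1994, Thm. 1 (1), p. 264] [cite: Washington1997, Prop. 4.11] [cite: Lang1990, Ch. 13 §4, Lemma 4.1] -/
theorem classNumberPExp_zero_add_le (hK2 : ¬ 2 ∣ Module.finrank ℚ K) (hrank : Units.rank K = 1)
    (κ : ZpExtension K 2) (hκ : κ.IsCyclotomic)
    (hodd : ∀ w : HeightOneSpectrum (𝓞 K), ((2 : ℕ) : 𝓞 K) ∈ w.asIdeal → Odd (w.asIdeal.ramificationIdx ℤ))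
    (h3 : 3 ≤ {w : HeightOneSpectrum (𝓞 K) | ((2 : ℕ) : 𝓞 K) ∈ w.asIdeal}.ncard) (n : ℕ) :
    classNumberPExp κ 0 + n ≤ classNumberPExp κ n := by
  induction n with
  | zero => simp
  | succ n ih =>
    have h := classNumberPExp_succ_le_succ hK2 hrank κ hκ hodd h3 n
    omega

/-- Cubic currency: **the `2`-class number at least doubles at every layer** of the cyclotomic `ℤ₂`-tower of a complex cubic field in which `2`
splits completely — `e_n + 1 ≤ e_{n+1}` and `e_0 + n ≤ e_n`. [cite: Fukuda1994, Thm. 1 (1), p. 264] [cite: Washington1997, Prop. 4.11]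
[cite: Lang1990, Ch. 13 §4, Lemma 4.1] -/
theorem classNumberPExp_strict_growth_of_cubic (F : Type) [Field F] [NumberField F] (hF : Module.finrank ℚ F = 3)
    (h1 : InfinitePlace.nrRealPlaces F = 1) (h3 : 3 ≤ {v : HeightOneSpectrum (𝓞 F) | ((2 : ℕ) : 𝓞 F) ∈ v.asIdeal}.ncard)
    (κ : ZpExtension F 2) (hκ : κ.IsCyclotomic) (n : ℕ) :
    classNumberPExp κ n + 1 ≤ classNumberPExp κ (n + 1) ∧ classNumberPExp κ 0 + n ≤ classNumberPExp κ n :=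
  ⟨classNumberPExp_succ_le_succ (by rw [hF]; norm_num) (units_rank_eq_one_of_nrRealPlaces_eq_one F hF h1) κ hκ
      (fun w hw => by rw [ramificationIdx_eq_one_of_three_le_ncard F hF h3 w hw]; exact odd_one) h3 n,
    classNumberPExp_zero_add_le (by rw [hF]; norm_num) (units_rank_eq_one_of_nrRealPlaces_eq_one F hF h1) κ hκ
      (fun w hw => by rw [ramificationIdx_eq_one_of_three_le_ncard F hF h3 w hw]; exact odd_one) h3 n⟩

end Monotone

/-! ## Seed form -/

section Seed

open WeierstrassCurve Polynomial IntermediateField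
  Literature.NumberTheory.EllipticCurves.Greenberg1999
  Summit.BirchSwinnertonDyer.Rank1Residual

variable (W : WeierstrassCurve ℚ) [W.IsElliptic]

/-- **THE KILFORD SEEDS' CUBIC TOWER: `e_{n+1} ≥ e_n + 1` and `e_n ≥ e_0 + n`** — `W/ℚ` elliptic with `Δ_W < 0`, no rational `2`-torsion abscissa,
`β` a root of the `2`-division cubic, three places above `2` in `ℚ(β)`; for every cyclotomic `ℤ₂`-extension `κP` of `ℚ(β)` and every `n` the
`2`-class number of the `n`-th layer is divisible by `2^{e_0 + n}` and at least doubles at the next layer. [cite: Fukuda1994, Thm. 1 (1), p. 264]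
[cite: Washington1997, Prop. 4.11] [cite: Lang1990, Ch. 13 §4, Lemma 4.1] -/
theorem classNumberPExp_strict_growth_seedCubicField (hΔ : W.Δ < 0) (ht : ∀ x : ℚ, ¬ HasRationalTwoTorsionX W x)
    {β : AlgebraicClosure ℚ} (hβ : aeval β W.twoTorsionPolynomial.toPoly = 0)
    (h3p : 3 ≤ {v : HeightOneSpectrum (𝓞 ↥(IntermediateField.adjoin ℚ ({β} : Set (AlgebraicClosure ℚ)))) |
      ((2 : ℕ) : 𝓞 ↥(IntermediateField.adjoin ℚ ({β} : Set (AlgebraicClosure ℚ)))) ∈ v.asIdeal}.ncard)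
    (κP : ZpExtension ↥(IntermediateField.adjoin ℚ ({β} : Set (AlgebraicClosure ℚ))) 2) (hκP : κP.IsCyclotomic) (n : ℕ) :
    classNumberPExp κP n + 1 ≤ classNumberPExp κP (n + 1) ∧ classNumberPExp κP 0 + n ≤ classNumberPExp κP n := by
  have hirr := AlignedTransportAtTwoSeed.irr_two_of_forall_not_hasRationalTwoTorsionX W ht
  have hβint : IsIntegral ℚ β := ((AlgebraicClosure.isAlgebraic ℚ).isAlgebraic β).isIntegral
  haveI : FiniteDimensional ℚ ↥(IntermediateField.adjoin ℚ ({β} : Set (AlgebraicClosure ℚ))) :=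
    IntermediateField.adjoin.finiteDimensional hβint
  haveI : NumberField ↥(IntermediateField.adjoin ℚ ({β} : Set (AlgebraicClosure ℚ))) := NumberField.mk
  have h3 : Module.finrank ℚ ↥(IntermediateField.adjoin ℚ ({β} : Set (AlgebraicClosure ℚ))) = 3 :=
    AddKatoTwo.finrank_adjoin_root_twoTorsionPolynomial_eq_three W hirr hβ
  have h1 := nrRealPlaces_adjoin_root_twoTorsionPolynomial_eq_one W hΔ hirr hβ
  exact classNumberPExp_strict_growth_of_cubic _ h3 h1 h3p κP hκP n

end Seed


end Summit.BirchSwinnertonDyer.BirchSwinnertonDyer.Theorems.AlignedTransportAtTwoCubicTowerStrict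

end
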